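import Literature.MathematicalPhysics.QuantumLattice.InfVolFermionStateTorusLimitTwoSectorSingleAnnihilator
import HarnessLib

/-!
# The two-sector row of a SINGLE CREATOR `c†_{x↑}` for the thermal object of record (image sector
# `(k_L + 1, k_L)`), and the brackets on the canonical chemical potential from the LIMIT rows

Topic `Literature/MathematicalPhysics/QuantumLattice`; complement of
`InfVolFermionStateTorusLimitTwoSectorSingleAnnihilator.lean` (the «rm↑» template `c_{x↑}`, image sector
`(k_L − 1, k_L)`). Two additions:

* §1 **abstract brackets from a family of linear rows** (pure real algebra, the content of
  `mul_log_le_of_twoSector_eeb` detached from matrices): if `0 ≤ β·h − s·x + q·r·y` for all real `s, q`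
  with `e^{s−1} ≤ q`, and `x, y, r > 0`, then `x·log(x/(r·y)) ≤ β·h`
  (`mul_log_le_of_forall_linear_rows`), hence `log(x/y) − β·h/x ≤ log r`
  (`log_div_sub_div_le_log_of_forall_linear_rows`); and from the reversed family
  `0 ≤ β·g − s·y + q·r⁻¹·x` the upper bracket `log r ≤ log(x/y) + β·g/y`
  (`log_le_log_div_add_div_of_forall_linear_rows`). These apply verbatim to the TORUS-LIMIT rows of
  `IsTorusLimitOfMixture.re_expect_twoSector_eeb_nonneg_of_sectorGibbs` (with `x = Re ω(ÃᴴÃ)`,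
  `y = Re ω'(ÃÃᴴ)`, `h = Re ω(Ãᴴ[H_{Λ₁},Ã])`) — so a relaxation may carry the bracket on its parameter `r`
  as a consequence of its own rows, and a priori from `|Re ω(X)| ≤ ‖X‖`.
* §2 **the «add↑» template** `A = c†_{x↑}` (`x ∈ Λ`): its torus embedding is the torus creator, which
  carries `(k, k)` into `(k + 1, k)` while its adjoint `c` carries `(k + 1, k)` back
  (`IsInSector.creation_up_mulVec`, `IsInSector.annihilation_up_mulVec` — no parity condition), hence
  (`IsTorusLimitOfMixture.re_expect_twoSector_eeb_creation_up_nonneg_of_sectorGibbs`) for every thermal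
  torus limit `ω` of record, every companion limit `ω'` of the sectors `(k_L + 1, k_L)` along the same `Ls`
  and `r = lim Z_{(k+1,k)}/Z_{(k,k)}` (the exponential of MINUS `β` times the canonical ADDITION cost):
  `0 ≤ β·Re ω_{Λ₁}(ã(H_{Λ₁}ã† − ã†H_{Λ₁})) − s·Re ω_{Λ₁}(ãã†) + q·r·Re ω'_{Λ₁}(ã†ã)`, `ã† = Γ_{Λ⊆Λ₁}c†_{x↑}`.

HONEST SCOPE: as in the companion files — rows for pairs of states, no claim `ω' = ω`; the bracket lemmas
need `x, y, r > 0` as inputs. Everything is PROVED; no definition, no named fact.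

## Mathlib / tree search

REUSED: `InfVolFermionState.re_expect_twoSector_eeb_nonneg_of_canonical_limits_eventually`,
`fermionEmbed_toTorusEmb_incl_annihilation` pattern (`…SingleAnnihilator`); `apply_eq_zero_off_of_mulVec_mem₂`,
`mem_szSector_iff_spinConfig`, `hubbardTorusTT'_apply_eq_zero_of_spinConfig`,
`fockTranslate_apply_eq_zero_of_spinConfig`, `IsInSector.creation_up_mulVec`,
`IsInSector.annihilation_up_mulVec`, `mem_szSector_iff_isInSector`, `fermionEmbed_creation`,
`creation_conjTranspose`, `mem_szSector_rectN_iff`, Mathlib `Real.exp_log`, `Real.log_div`, `Real.log_mul`,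
`Real.log_inv`, `le_div_iff₀`. `lean search 'forall_linear_rows|creation.*twoSector'`: nothing (2026-08-27).

## References

* O. Bratteli, D. W. Robinson, *Operator Algebras and Quantum Statistical Mechanics 2* (1997),
  Thm. 5.3.15 (the auto-correlation lower bound as a supremum of linear inequalities), §5.4.2.
  [cite: BratteliRobinsonII1997, Thm. 5.3.15]
* H. Fawzi, O. Fawzi, S. O. Scalet (2024), Thm. 3.1 (`x log(x/y) = sup_s (s x − e^{s−1} y)`).
  [cite: FawziFawziScalet2024, Thm. 3.1]
* E. H. Lieb, Phys. Rev. Lett. 62 (1989) 1201, eq. (2). [cite: LiebPRL1989, proof of Theorem 1]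
-/

noncomputable section

namespace Literature.MathematicalPhysics.QuantumLattice

open Matrix Finset HubbardWave0 Literature.Probability.LatticeModels ThermodynamicLimit
open _root_.Filter
open scoped _root_.Topology ComplexOrder BigOperators

/-! ### §1 Brackets from a family of linear rows -/

section Brackets

/-- **The Araki–Sewell function from its linearisations.** If `0 ≤ β·h − s·x + q·r·y` for all real
`s, q` with `e^{s−1} ≤ q`, and `x, y, r > 0`, then `x·log(x/(r·y)) ≤ β·h` (take
`s = 1 + log(x/(r y))`, `q = e^{s−1}`). [cite: FawziFawziScalet2024, Thm. 3.1]
[cite: BratteliRobinsonII1997, Thm. 5.3.15] -/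
theorem mul_log_le_of_forall_linear_rows {x y r h β : ℝ} (hx : 0 < x) (hy : 0 < y) (hr : 0 < r)
    (hrows : ∀ s q : ℝ, Real.exp (s - 1) ≤ q → 0 ≤ β * h - s * x + q * r * y) :
    x * Real.log (x / (r * y)) ≤ β * h := by
  have hq : Real.exp ((1 + Real.log (x / (r * y))) - 1) ≤ x / (r * y) := by
    rw [add_sub_cancel_left, Real.exp_log (div_pos hx (mul_pos hr hy))]
  have h := hrows (1 + Real.log (x / (r * y))) (x / (r * y)) hq
  have hqry : x / (r * y) * r * y = x := by field_simp
  nlinarith [h, hqry]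

/-- **Lower bracket from the rows**: under the same hypotheses `log(x/y) − β·h/x ≤ log r`.
[cite: BratteliRobinsonII1997, §5.4.2] [cite: FawziFawziScalet2024, Thm. 3.1] -/
theorem log_div_sub_div_le_log_of_forall_linear_rows {x y r h β : ℝ} (hx : 0 < x) (hy : 0 < y)
    (hr : 0 < r) (hrows : ∀ s q : ℝ, Real.exp (s - 1) ≤ q → 0 ≤ β * h - s * x + q * r * y) :
    Real.log (x / y) - β * h / x ≤ Real.log r := by
  have hmain := mul_log_le_of_forall_linear_rows hx hy hr hrows
  have hsplit : Real.log (x / (r * y)) = Real.log (x / y) - Real.log r := by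
    rw [Real.log_div hx.ne' (mul_pos hr hy).ne', Real.log_mul hr.ne' hy.ne', Real.log_div hx.ne' hy.ne']
    ring
  rw [hsplit] at hmain
  have hdiv : Real.log (x / y) - Real.log r ≤ β * h / x := by
    rw [le_div_iff₀ hx]; linarith
  linarith

/-- **Upper bracket from the reversed rows**: if `0 ≤ β·g − s·y + q·r⁻¹·x` for all `e^{s−1} ≤ q` (the
rows of the adjoint generator read from the image sector, whose partition-function ratio is `r⁻¹`), and
`x, y, r > 0`, then `log r ≤ log(x/y) + β·g/y`. [cite: BratteliRobinsonII1997, §5.4.2]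
[cite: FawziFawziScalet2024, Thm. 3.1] -/
theorem log_le_log_div_add_div_of_forall_linear_rows {x y r g β : ℝ} (hx : 0 < x) (hy : 0 < y)
    (hr : 0 < r) (hrows : ∀ s q : ℝ, Real.exp (s - 1) ≤ q → 0 ≤ β * g - s * y + q * r⁻¹ * x) :
    Real.log r ≤ Real.log (x / y) + β * g / y := by
  have h := log_div_sub_div_le_log_of_forall_linear_rows hy hx (inv_pos.2 hr) hrows
  rw [Real.log_inv, Real.log_div hy.ne' hx.ne'] at h
  rw [Real.log_div hx.ne' hy.ne']
  linarith

end Brackets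

/-! ### §2 The single creator `c†_{x↑}`: its torus embedding raises `N↑` by one -/

section Creator

variable (L : ℕ) [NeZero L]

/-- The torus embedding of the local creator `c†_{x↑} ∈ 𝔄_Λ` (through `𝔄_{Λ₁}`) is the torus creator at
the image site. [cite: ArakiMoriya2003, §4.1 Def. 4.3] -/
theorem fermionEmbed_toTorusEmb_incl_creation {Λ : Finset (Site 2)}
    (h₁ : Set.InjOn (Torus.proj (d := 2) L) ↑(thicken Λ 1)) {x : Site 2} (hx : x ∈ Λ) (σ : Fin 2) :
    fermionEmbed (PolySite.toTorusEmb L h₁)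
        (fermionEmbed (PolySite.incl (subset_thicken Λ 1)) (creation (orb (PolySite.pt x hx) σ))) =
      creation (orb (PolySite.toTorusEmb L h₁ (PolySite.incl (subset_thicken Λ 1) (PolySite.pt x hx))) σ) := by
  rw [fermionEmbed_creation, fermionEmbed_creation]

omit [NeZero L] in
/-- **`c†_{y↑}` carries the sector `(rectN n L, S^z = 0) = (k, k)` into `(k + 1, k)`.**
[cite: LiebPRL1989, proof of Theorem 1] -/
theorem creation_up_mulVec_mem_szSector_succ {n : ℝ} (y : FermionTorus 2 L)
    (w : Fock (Orb (FermionTorus 2 L))) (hw : w ∈ szSector (rectN n L) (0 : ℝ)) :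
    creation (orb y 0) *ᵥ w ∈
      szSector ((halfRectN n L + 1) + halfRectN n L) ((((halfRectN n L + 1 : ℕ) : ℝ) - halfRectN n L) / 2) := by
  rw [mem_szSector_iff_isInSector]
  have hw' : IsInSector (halfRectN n L) (halfRectN n L) w := (mem_szSector_rectN_iff n L w).1 hw
  exact hw'.creation_up_mulVec y

omit [NeZero L] in
/-- **`c_{y↑} = (c†_{y↑})ᴴ` carries the sector `(k + 1, k)` back into `(k, k) = (rectN n L, S^z = 0)`.**
[cite: LiebPRL1989, proof of Theorem 1] -/
theorem annihilation_up_mulVec_mem_szSector_rectN_of_succ {n : ℝ} (y : FermionTorus 2 L)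
    (w : Fock (Orb (FermionTorus 2 L)))
    (hw : w ∈ szSector ((halfRectN n L + 1) + halfRectN n L) ((((halfRectN n L + 1 : ℕ) : ℝ) - halfRectN n L) / 2)) :
    (creation (orb y 0))ᴴ *ᵥ w ∈ szSector (rectN n L) (0 : ℝ) := by
  rw [creation_conjTranspose, mem_szSector_rectN_iff]
  have hw' : IsInSector (halfRectN n L + 1) (halfRectN n L) w := (mem_szSector_iff_isInSector _ _ w).1 hw
  exact hw'.annihilation_up_mulVec y

end Creator

/-! ### §3 The «add↑» row for the thermal object of record -/

section Record

variable (t t' U β : ℝ)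

/-- **The two-sector row of the single creator `c†_{x↑}` for the thermal object of record.** Let `ω` be
a torus limit of the canonical Gibbs states of `hubbardTorusTT' (Ls j) t t' U` at inverse temperature `β`
on the sectors `(rectN n (Ls j), S^z = 0)` along `Ls → ∞`, let `ω'` be a torus limit ALONG THE SAME `Ls`
of the canonical Gibbs states on the spin sectors `(k_L + 1, k_L)` (`k_L = halfRectN n L`; the image of
`c†_{x↑}`), and `r = lim_j Z_{(k+1,k)}(Ls j)/Z_{(k,k)}(Ls j)`. Then for `x ∈ Λ`, `ã† = Γ_{Λ⊆Λ₁}c†_{x↑}`,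
`Λ₁ = thicken Λ 1`, and all real `s, q` with `e^{s−1} ≤ q`:
`0 ≤ β·Re ω_{Λ₁}(ã(H^{tt'U}_{Λ₁}ã† − ã†H^{tt'U}_{Λ₁})) − s·Re ω_{Λ₁}(ãã†) + q·r·Re ω'_{Λ₁}(ã†ã)` — the
«add↑» row of a thermal relaxation for the canonical object, sector mapping discharged.
[cite: FawziFawziScalet2024, Thm. 3.1] [cite: BratteliRobinsonII1997, §5.4.2]
[cite: LiebPRL1989, proof of Theorem 1] -/
theorem InfVolFermionState.IsTorusLimitOfMixture.re_expect_twoSector_eeb_creation_up_nonneg_of_sectorGibbs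
    {n : ℝ} {Ls : ℕ → ℕ} (hLs : Tendsto Ls atTop atTop) {ω ω' : InfVolFermionState 2}
    (hω : ω.IsTorusLimitOfMixture (sectorGibbsCount n) (fun L => sectorGibbsWeightTT' β t t' U n L)
      (fun L => sectorGibbsVectorTT' t t' U n L) Ls)
    (hω' : ω'.IsTorusLimitOfMixture
      (fun L => Fintype.card (Subtype (spinConfig (Λ := FermionTorus 2 L) (halfRectN n L + 1) (halfRectN n L))))
      (fun L i => canonicalWeight β (sectorEigenvalue (spinConfig (halfRectN n L + 1) (halfRectN n L))
        (hubbardTorusTT' L t t' U) (hubbardTorusTT'_isHermitian L t t' U)) ((Fintype.equivFin _).symm i))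
      (fun L i => sectorEigenvector (spinConfig (halfRectN n L + 1) (halfRectN n L)) (hubbardTorusTT' L t t' U)
        (hubbardTorusTT'_isHermitian L t t' U) ((Fintype.equivFin _).symm i)) Ls)
    {r : ℝ} (hr : Tendsto (fun j =>
      (∑ d, Real.exp (-(β * sectorEigenvalue (spinConfig (halfRectN n (Ls j) + 1) (halfRectN n (Ls j)))
          (hubbardTorusTT' (Ls j) t t' U) (hubbardTorusTT'_isHermitian (Ls j) t t' U) d))) /
        ∑ c, Real.exp (-(β * sectorEigenvalue (szConfig n (Ls j)) (hubbardTorusTT' (Ls j) t t' U)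
          (hubbardTorusTT'_isHermitian (Ls j) t t' U) c))) atTop (𝓝 r))
    {Λ : Finset (Site 2)} {x : Site 2} (hx : x ∈ Λ) {s q : ℝ} (hq : Real.exp (s - 1) ≤ q) :
    0 ≤ β * (ω.expect (thicken Λ 1)
          ((fermionEmbed (PolySite.incl (subset_thicken Λ 1)) (creation (orb (PolySite.pt x hx) 0)))ᴴ *
            ((hubbardTTPrimeFermionInteraction t t' U).localHamiltonian (thicken Λ 1) *
                fermionEmbed (PolySite.incl (subset_thicken Λ 1)) (creation (orb (PolySite.pt x hx) 0)) -
              fermionEmbed (PolySite.incl (subset_thicken Λ 1)) (creation (orb (PolySite.pt x hx) 0)) *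
                (hubbardTTPrimeFermionInteraction t t' U).localHamiltonian (thicken Λ 1)))).re -
        s * (ω.expect (thicken Λ 1)
          ((fermionEmbed (PolySite.incl (subset_thicken Λ 1)) (creation (orb (PolySite.pt x hx) 0)))ᴴ *
            fermionEmbed (PolySite.incl (subset_thicken Λ 1)) (creation (orb (PolySite.pt x hx) 0)))).re +
        q * r * (ω'.expect (thicken Λ 1)
          (fermionEmbed (PolySite.incl (subset_thicken Λ 1)) (creation (orb (PolySite.pt x hx) 0)) *
            (fermionEmbed (PolySite.incl (subset_thicken Λ 1)) (creation (orb (PolySite.pt x hx) 0)))ᴴ)).re := by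
  -- the weights of record are the canonical weights, reindexed
  have hwrec : ∀ L (i : Fin (sectorGibbsCount n L)), sectorGibbsWeightTT' β t t' U n L i =
      canonicalWeight β (sectorEigenvalue (szConfig n L) (hubbardTorusTT' L t t' U)
        (hubbardTorusTT'_isHermitian L t t' U)) (sectorGibbsIndex n L i) := by
    intro L i
    rw [sectorGibbsWeightTT', show sectorGibbsEnergyTT' t t' U n L =
      sectorEigenvalue (szConfig n L) (hubbardTorusTT' L t t' U) (hubbardTorusTT'_isHermitian L t t' U) ∘
        sectorGibbsIndex n L from rfl]
    unfold canonicalWeight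
    rw [show (∑ b, Real.exp (-(β * (sectorEigenvalue (szConfig n L) (hubbardTorusTT' L t t' U)
        (hubbardTorusTT'_isHermitian L t t' U) ∘ sectorGibbsIndex n L) b))) =
      ∑ b, Real.exp (-(β * sectorEigenvalue (szConfig n L) (hubbardTorusTT' L t t' U)
        (hubbardTorusTT'_isHermitian L t t' U) b)) from
      Equiv.sum_comp (sectorGibbsIndex n L) (fun b => Real.exp (-(β * sectorEigenvalue (szConfig n L)
        (hubbardTorusTT' L t t' U) (hubbardTorusTT'_isHermitian L t t' U) b)))]
    rfl
  refine InfVolFermionState.re_expect_twoSector_eeb_nonneg_of_canonical_limits_eventually t t' U β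
    (fun L => szConfig n L) (fun L => spinConfig (Λ := FermionTorus 2 L) (halfRectN n L + 1) (halfRectN n L))
    (fun L s s' hs hs' => hubbardTorusTT'_apply_eq_zero_of_szConfig L t t' U n s s' hs hs')
    (fun L s s' hs hs' => hubbardTorusTT'_apply_eq_zero_of_spinConfig L t t' U _ _ s s' hs hs')
    (fun L _ v s s' hs hs' => fockTranslate_apply_eq_zero_of_szConfig L v n s s' hs hs')
    (fun L _ v s s' hs hs' => fockTranslate_apply_eq_zero_of_spinConfig L v _ _ s s' hs hs')
    (fun L => sectorGibbsIndex n L) (fun L => (Fintype.equivFin _).symm)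
    hwrec (fun L i => rfl) (fun L i => rfl) (fun L i => rfl) hLs hω hω' hr
    (creation (orb (PolySite.pt x hx) 0)) ?_ ?_ hq
  · filter_upwards with j hL h₁ s s' hs hs'
    rw [fermionEmbed_toTorusEmb_incl_creation]
    exact apply_eq_zero_off_of_mulVec_mem₂ (szConfig n (Ls j)) (spinConfig _ _)
      (szSector (rectN n (Ls j)) 0) (szSector _ _) (mem_szSector_rectN_iff n (Ls j))
      (mem_szSector_iff_spinConfig (Ls j) _ _)
      (fun w hw => creation_up_mulVec_mem_szSector_succ (Ls j) _ w hw) s s' hs hs'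
  · filter_upwards with j hL h₁ s s' hs hs'
    rw [fermionEmbed_toTorusEmb_incl_creation]
    exact apply_eq_zero_off_of_mulVec_mem₂ (spinConfig _ _) (szConfig n (Ls j))
      (szSector _ _) (szSector (rectN n (Ls j)) 0) (mem_szSector_iff_spinConfig (Ls j) _ _)
      (mem_szSector_rectN_iff n (Ls j))
      (fun w hw => annihilation_up_mulVec_mem_szSector_rectN_of_succ (Ls j) _ w hw) s s' hs hs'

end Record

end Literature.MathematicalPhysics.QuantumLattice

end
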